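import Summits.HodgeConjecture.HodgeConjecture.Theorems.Ring2WeilCoverageCMFieldNormResidueSymbolsPlaces
import Summits.HodgeConjecture.HodgeConjecture.Theorems.Ring2WeilCoverageCMFieldCellsKaehlerIffAnyCM
import HarnessLib

/-!
# Ring 2 — Weil-family coverage, CM-field rows: the POLARIZED components `W_{2k}.E.δ` (`k` even) are classified
  by the finite even subsets of the non-split finite places of `F` (WEIL-FAMILY-COVERAGE «## b03», cell (ix′), part 4)

research route conditional on HC_CM; not a corollary; Q11.4-sentence-2 already refuted in dim ≥ 3.

Junction of `Ring2WeilCoverageCMFieldNormResidueSymbols[Places]` (this seat, gen 62: `[q] = [q'] ⟺ T(q) = T(q')`,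
`|T(q)|` even, realisation of every even `T`, infinite places ⟺ total positivity) with
`Ring2WeilCoverageCMFieldCellsKaehlerIffAnyCM` (gen 55, X-I: a row `W8.E.[q]` carries a POLARIZED Weil-type CM member
iff `q` is totally positive), on Deligne's carriers with Deligne's presentation `R(T²) = minpoly(b₀)` of a CM number
field `K` [cite: Deligne1982HodgeCycles, §4: display (1), Prop. 4.1, Cor. 4.2; §5 (c)]:

* `exists_cm_kaehler_member_two_iff_badPlaces_subset_range_inl` — a row `W8.E.[q]` carries a polarized Weil-type CM
  member iff `T(q)` contains NO infinite place;
* `mk_eq_mk_iff_finite_badPlaces_eq_of_members` — two such rows coincide iff their FINITE `T`-sets agree;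
* `exists_polarized_row_finite_badPlaces_eq` — every finite EVEN set of finite places of `F` non-split in `E` is the
  finite `T`-set of a row carrying a polarized Weil-type CM member.
So «the components are indexed by `(E, d, δ)`, `δ ↔` the finite even sets `T` of non-split places» (§b03.2 / §b03.5,
Landherr–Deligne) holds in the kernel for the polarized `g = 8e₀` rows of EVERY carrier.  No new definition, no named
fact, no sorry.
-/

noncomputable section

set_option linter.dupNamespace false

open CategoryTheory Polynomial NumberField IsDedekindDomain

namespace Summit.HodgeConjecture.HodgeConjecture.Ring2.WeilCoverageCM

open Literature.AlgebraicTopology.SingularHomology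
open Literature.AlgebraicGeometry Literature.AlgebraicGeometry.Motives Literature.AlgebraicGeometry.HodgeTheory
open Literature.AlgebraicGeometry.Deligne1982 Literature.AlgebraicGeometry.Milne1999
open Literature.NumberTheory.QuadraticForms
open Summit.HodgeConjecture.HodgeConjecture.Ring2.Hypotheses (RosatiCompatible IsKaehlerMultiple)

variable (K : Type) [Field K] [NumberField K] [IsCMField K]

/-- **A row `W8.E.[q]` carries a POLARIZED Weil-type CM member iff `T(q)` has no infinite place** (X-I's «iff
`q` totally positive» read through `badPlaces_subset_range_inl_iff_totallyPositive`).
[cite: Deligne1982HodgeCycles, §4 (1) and §5 (c)] [cite: Omeara1963, §63B (the symbol over `ℝ`)] -/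
theorem exists_cm_kaehler_member_two_iff_badPlaces_subset_range_inl (hK : 2 < Module.finrank ℚ K)
    {b₀ : 𝓞 K} (hb₀ : IsCMField.complexConj K (b₀ : K) = -(b₀ : K))
    (hsep : Function.Injective fun σ : K →+* ℂ => σ (b₀ : K))
    {R : Polynomial ℤ} {e₀ : ℕ} (he : Module.finrank ℚ K = 2 * e₀) (hRm : R.Monic) (hRdeg : R.natDegree = e₀)
    (hR : R.comp (X ^ 2) = minpoly ℤ b₀) (hirr : Irreducible (cmPolyQ R))
    (hroots : ∀ s : ℂ, Polynomial.eval₂ (Int.castRingHom ℂ) s R = 0 → s.im = 0 ∧ s.re < 0)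
    (haev : Polynomial.aeval (b₀ : K) (cmPolyQ R) = 0) (hdegQ : (cmPolyQ R).natDegree = Module.finrank ℚ K)
    [Fact (Irreducible (realPolyQ R))] (q : (realField R)ˣ) :
    (∃ (A : AbelianVariety ℂ) (η : A ⟶ A) (h : complexBetti A.X 2), A.dim = 2 * 2 * e₀ ∧ IsOfCMType A ∧
      IsWeilTypeCM A η R e₀ 2 ∧ IsRationalClass h ∧ RosatiCompatible A η h ∧ IsKaehlerMultiple A h ∧
      HasWeilDiscriminantCM A η R e₀ 2 h (QuotientGroup.mk q : cmNormResidueGroup R)) ↔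
    badPlaces (q : realField R) (AdjoinRoot.root (realPolyQ R)) ⊆ Set.range Sum.inl := by
  haveI : Fact (Irreducible (cmPolyQ R)) := ⟨hirr⟩
  rw [exists_cm_kaehler_member_two_iff_totallyPositive' K hK hb₀ hsep he hRm hRdeg hR hirr hroots haev hdegQ q,
    forall_re_embedding_pos_iff_totallyPositive hroots, badPlaces_subset_range_inl_iff_totallyPositive hroots]

/-- **Two rows with polarized members coincide iff their FINITE `T`-sets agree.**
[cite: Deligne1982HodgeCycles, §4 (1) and Prop. 4.1] [cite: Omeara1963, §65D Thm. 65:23] -/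
theorem mk_eq_mk_iff_finite_badPlaces_eq_of_members (hK : 2 < Module.finrank ℚ K)
    {b₀ : 𝓞 K} (hb₀ : IsCMField.complexConj K (b₀ : K) = -(b₀ : K))
    (hsep : Function.Injective fun σ : K →+* ℂ => σ (b₀ : K))
    {R : Polynomial ℤ} {e₀ : ℕ} (he : Module.finrank ℚ K = 2 * e₀) (hRm : R.Monic) (hRdeg : R.natDegree = e₀)
    (hR : R.comp (X ^ 2) = minpoly ℤ b₀) (hirr : Irreducible (cmPolyQ R))
    (hroots : ∀ s : ℂ, Polynomial.eval₂ (Int.castRingHom ℂ) s R = 0 → s.im = 0 ∧ s.re < 0)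
    (haev : Polynomial.aeval (b₀ : K) (cmPolyQ R) = 0) (hdegQ : (cmPolyQ R).natDegree = Module.finrank ℚ K)
    [Fact (Irreducible (realPolyQ R))] {q q' : (realField R)ˣ}
    (hq : ∃ (A : AbelianVariety ℂ) (η : A ⟶ A) (h : complexBetti A.X 2), A.dim = 2 * 2 * e₀ ∧ IsOfCMType A ∧
      IsWeilTypeCM A η R e₀ 2 ∧ IsRationalClass h ∧ RosatiCompatible A η h ∧ IsKaehlerMultiple A h ∧
      HasWeilDiscriminantCM A η R e₀ 2 h (QuotientGroup.mk q : cmNormResidueGroup R))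
    (hq' : ∃ (A : AbelianVariety ℂ) (η : A ⟶ A) (h : complexBetti A.X 2), A.dim = 2 * 2 * e₀ ∧ IsOfCMType A ∧
      IsWeilTypeCM A η R e₀ 2 ∧ IsRationalClass h ∧ RosatiCompatible A η h ∧ IsKaehlerMultiple A h ∧
      HasWeilDiscriminantCM A η R e₀ 2 h (QuotientGroup.mk q' : cmNormResidueGroup R)) :
    (QuotientGroup.mk q : cmNormResidueGroup R) = QuotientGroup.mk q' ↔
      {v : HeightOneSpectrum (𝓞 (realField R)) |
          hilbertSymbol (v.adicCompletion (realField R)) (algebraMap (realField R) _ (q : realField R))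
            (algebraMap (realField R) _ (AdjoinRoot.root (realPolyQ R))) = -1} =
        {v : HeightOneSpectrum (𝓞 (realField R)) |
          hilbertSymbol (v.adicCompletion (realField R)) (algebraMap (realField R) _ (q' : realField R))
            (algebraMap (realField R) _ (AdjoinRoot.root (realPolyQ R))) = -1} := by
  haveI : Fact (Irreducible (cmPolyQ R)) := ⟨hirr⟩
  have hpos := (exists_cm_kaehler_member_two_iff_totallyPositive' K hK hb₀ hsep he hRm hRdeg hR hirr hroots haev
    hdegQ q).1 hq
  have hpos' := (exists_cm_kaehler_member_two_iff_totallyPositive' K hK hb₀ hsep he hRm hRdeg hR hirr hroots haev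
    hdegQ q').1 hq'
  rw [forall_re_embedding_pos_iff_totallyPositive hroots] at hpos hpos'
  exact mk_eq_mk_iff_finite_badPlaces_eq hroots hpos hpos'

/-- **REALISATION: every finite EVEN set `S` of finite places of `F` non-split in `E` (`θ ∉ F_v²`) is the finite
`T`-set of a row `W8.E.[q]` carrying a POLARIZED Weil-type CM member** — with the two preceding theorems: the polarized
`g = 8e₀` components over `E` are in canonical bijection with these sets `S` (Landherr–Deligne indexing, §b03.2/§b03.5).
[cite: Deligne1982HodgeCycles, §4 (1), Prop. 4.1 and §5 (c)] [cite: Omeara1963, §71 Thm. 71:19 and Cor. 71:19a]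
[cite: Landherr1936HermitianForms] -/
theorem exists_polarized_row_finite_badPlaces_eq (hK : 2 < Module.finrank ℚ K)
    {b₀ : 𝓞 K} (hb₀ : IsCMField.complexConj K (b₀ : K) = -(b₀ : K))
    (hsep : Function.Injective fun σ : K →+* ℂ => σ (b₀ : K))
    {R : Polynomial ℤ} {e₀ : ℕ} (he : Module.finrank ℚ K = 2 * e₀) (hRm : R.Monic) (hRdeg : R.natDegree = e₀)
    (hR : R.comp (X ^ 2) = minpoly ℤ b₀) (hirr : Irreducible (cmPolyQ R))
    (hroots : ∀ s : ℂ, Polynomial.eval₂ (Int.castRingHom ℂ) s R = 0 → s.im = 0 ∧ s.re < 0)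
    (haev : Polynomial.aeval (b₀ : K) (cmPolyQ R) = 0) (hdegQ : (cmPolyQ R).natDegree = Module.finrank ℚ K)
    [Fact (Irreducible (realPolyQ R))] (S : Finset (HeightOneSpectrum (𝓞 (realField R)))) (hS : Even S.card)
    (hns : ∀ v ∈ S, ¬ IsSquare (algebraMap (realField R) (v.adicCompletion (realField R))
      (AdjoinRoot.root (realPolyQ R)))) :
    ∃ q : (realField R)ˣ,
      (∃ (A : AbelianVariety ℂ) (η : A ⟶ A) (h : complexBetti A.X 2), A.dim = 2 * 2 * e₀ ∧ IsOfCMType A ∧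
        IsWeilTypeCM A η R e₀ 2 ∧ IsRationalClass h ∧ RosatiCompatible A η h ∧ IsKaehlerMultiple A h ∧
        HasWeilDiscriminantCM A η R e₀ 2 h (QuotientGroup.mk q : cmNormResidueGroup R)) ∧
      {v : HeightOneSpectrum (𝓞 (realField R)) |
          hilbertSymbol (v.adicCompletion (realField R)) (algebraMap (realField R) _ (q : realField R))
            (algebraMap (realField R) _ (AdjoinRoot.root (realPolyQ R))) = -1} = ↑S := by
  haveI : Fact (Irreducible (cmPolyQ R)) := ⟨hirr⟩
  obtain ⟨q, hq, hT⟩ := exists_totallyPositive_badPlaces_eq hroots S hS hns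
  refine ⟨q, ?_, hT⟩
  rw [exists_cm_kaehler_member_two_iff_totallyPositive' K hK hb₀ hsep he hRm hRdeg hR hirr hroots haev hdegQ q,
    forall_re_embedding_pos_iff_totallyPositive hroots]
  exact hq

end Summit.HodgeConjecture.HodgeConjecture.Ring2.WeilCoverageCM

end
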